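import Mathlib.LinearAlgebra.Matrix.ProjectiveSpecialLinearGroup
import Literature.RepresentationTheory.FiniteGroups.SL2Sym4CohomologyF7
import HarnessLib

/-!
# `H¹(PSL₂(𝔽₇), Sym⁴ 𝔽₇²) ≠ 0` — descent of the Cline–Parshall–Scott class to `PSL₂`

RepresentationTheory/FiniteGroups file, sequel of `SL2Sym4CohomologyF7.lean` (which proves
`H¹(SL₂(𝔽₇), Sym⁴) ≠ 0` by the explicit cocycle `c(g) = (g · e - e)/D`); definitions
(`psl2SymRep`, `psl2Sym`, the descended cocycle) and fully PROVED theorems; no named facts.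

* `symAct_scalar_of_mem` — a scalar matrix `r · 1` acts on binary forms of degree `n` by `r^n`;
  `sl2SymRep_eq_one_of_mem_center` — the centre `{r · 1 | r² = 1}` of `SL₂(k)` (Mathlib
  `Matrix.SpecialLinearGroup.mem_center_iff`) acts trivially on forms of EVEN degree;
* `psl2SymRep k n hn : Representation k PSL(2, k) (BinaryForms k n)` (`n` even) — `Sym^n`
  descended to Mathlib's `Matrix.ProjectiveSpecialLinearGroup (Fin 2) k = SL₂(k) ⧸ Z(SL₂(k))`
  (`QuotientGroup.lift`), `psl2Sym k n hn = Rep.of _`, `psl2SymRep_mk : Sym^n(ḡ) = Sym^n(g)`;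
* `cpsCocycleFun_eq_zero_of_mem_center` (`c(±1) = 0` since `(±1) · e = e`, `e` of even degree
  `12`), `pslCocycleFun`/`pslCocycle` (the descended cocycle `c̄(ḡ) = c(g)`), and
* `nontrivial_H1_psl2Sym_four_zmod_seven` — **`H¹(PSL₂(𝔽₇), Sym⁴) ≠ 0`**: a coboundary
  `ḡ ↦ ḡ · m - m` on `PSL₂` would pull back to the coboundary `g ↦ g · m - m` equal to `c` on
  `SL₂`, contradicting `cpsCocycleFun_not_coboundary`.

This is the form in which the non-vanishing enters the Langlands summit (route `PSL2ArtinDoor`,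
item `BadTWPrimeKlein`): for a subgroup `H ≤ GL₃(𝔽̄₇)` isomorphic to `PSL₂(𝔽₇)` acting through
`L(2) = Ad⁰`, one has `ad⁰ L(2) ≅ L(4) ⊕ L(2)` (`p = 7`) and `H¹(H, L(4)) ≠ 0`, so the
`H¹(H, ad⁰) = 0` clause of Thorne's adequacy (J. Inst. Math. Jussieu 11 (2012), Def. 2.3) fails.
(Abstractly: inflation `H¹(PSL₂(𝔽₇), Sym⁴) → H¹(SL₂(𝔽₇), Sym⁴)` is an isomorphism because
`{±1}` has order prime to `7`; here the explicit class is descended instead.) Literature: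
Humphreys 2006, §12.2, Proposition (b) (`dim Ext_{SL(2,p)}(L(0), L(p-3)) = 1`, `p` odd; the
`1`-block of `SL(2,p)` is inherited by `PSL(2,p)`, §11.5); Andersen–Jørgensen–Landrock 1983.

## References

* J. E. Humphreys, *Modular Representations of Finite Groups of Lie Type*, LMS Lecture Note
  Series 326, CUP (2006), §12.2 Proposition (b), §11.5. [Humphreys2005]
* H. H. Andersen, J. Jørgensen, P. Landrock, Proc. London Math. Soc. (3) 46 (1983) 38–52.
  [AndersenJorgensenLandrock1983]
* E. Cline, B. Parshall, L. Scott, Publ. Math. IHÉS 45 (1975) 169–191. [ClineParshallScott1975]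
-/

noncomputable section

open MvPolynomial
open Literature.RepresentationTheory.AlgebraicGroups.SL2Sym

namespace Literature.RepresentationTheory.FiniteGroups

/-! ### Descent to `PSL₂(𝔽₇) = SL₂(𝔽₇)/{±1}` -/

section ScalarAction

variable {k : Type*} [CommRing k]

/-- A scalar matrix `r · 1` acts on a binary form of degree `n` by `r^n`. [folklore] -/
theorem symAct_scalar_of_mem {n : ℕ} (r : k) {φ : MvPolynomial (Fin 2) k}
    (hφ : φ ∈ BinaryForms k n) :
    symAct (Matrix.scalar (Fin 2) r) φ = r ^ n • φ := by
  have hh : φ.IsHomogeneous n := (mem_homogeneousSubmodule n φ).1 hφ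
  have hs : (Matrix.scalar (Fin 2) r : Matrix (Fin 2) (Fin 2) k) = Matrix.diagonal ![r, r] := by
    ext i j
    fin_cases i <;> fin_cases j <;> simp
  conv_lhs => rw [eq_sum_coeff_smul_mono hh, map_sum]
  conv_rhs => rw [eq_sum_coeff_smul_mono hh, Finset.smul_sum]
  refine Finset.sum_congr rfl fun i _ => ?_
  rw [map_smul, hs, symAct_diagonal_mono, ← pow_add, Nat.sub_add_cancel (Nat.le_of_lt_succ i.2),
    smul_comm]

/-- The centre of `SL₂(k)` acts trivially on binary forms of even degree: a central element is
`r · 1` with `r² = 1` (Mathlib `Matrix.SpecialLinearGroup.mem_center_iff`). [folklore] -/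
theorem sl2SymRep_eq_one_of_mem_center {n : ℕ} (hn : Even n)
    {z : Matrix.SpecialLinearGroup (Fin 2) k}
    (hz : z ∈ Subgroup.center (Matrix.SpecialLinearGroup (Fin 2) k)) :
    sl2SymRep k n z = 1 := by
  obtain ⟨r, hr, hrz⟩ := Matrix.SpecialLinearGroup.mem_center_iff.1 hz
  simp only [Fintype.card_fin] at hr
  obtain ⟨m, hm⟩ := hn
  have hrn : r ^ n = 1 := by rw [hm, ← two_mul, pow_mul, hr, one_pow]
  refine LinearMap.ext fun φ => Subtype.ext ?_
  rw [sl2SymRep_apply_coe, ← hrz]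
  change symAct (Matrix.scalar (Fin 2) r) (φ : MvPolynomial (Fin 2) k) = φ
  rw [symAct_scalar_of_mem r φ.2, hrn, one_smul]

variable (k) in
/-- **`Sym^n` for even `n` as a representation of `PSL₂(k) = SL₂(k)/Z(SL₂(k))`** (the centre,
`{r · 1 | r² = 1}`, acts trivially). [folklore] -/
def psl2SymRep (n : ℕ) (hn : Even n) :
    Representation k (Matrix.ProjectiveSpecialLinearGroup (Fin 2) k) (BinaryForms k n) :=
  QuotientGroup.lift _ (sl2SymRep k n) fun _ hz => sl2SymRep_eq_one_of_mem_center hn hz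

/-- `Sym^n(ḡ) = Sym^n(g)`. [folklore] -/
@[simp] theorem psl2SymRep_mk {n : ℕ} (hn : Even n) (g : Matrix.SpecialLinearGroup (Fin 2) k) :
    psl2SymRep k n hn (QuotientGroup.mk g) = sl2SymRep k n g :=
  QuotientGroup.lift_mk _ _ g

end ScalarAction

section RepPSL

universe u
variable (k : Type u) [CommRing k]

/-- `Sym^n` (`n` even) as an object of `Rep k PSL₂(k)`. [folklore] -/
abbrev psl2Sym (n : ℕ) (hn : Even n) : Rep k (Matrix.ProjectiveSpecialLinearGroup (Fin 2) k) :=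
  Rep.of (psl2SymRep k n hn)

end RepPSL

section SevenPSL

/-- `7` is prime (local instance for `ZMod 7` a field). [folklore] -/
local instance fact_prime_seven' : Fact (Nat.Prime 7) := ⟨by norm_num⟩

/-- `4` is even. [folklore] -/
theorem even_four : Even 4 := ⟨2, rfl⟩

/-- `e` is a binary form of degree `12`. [folklore] -/
theorem e7_mem : e7 ∈ BinaryForms (ZMod 7) 12 := by
  unfold e7
  refine Submodule.add_mem _ (Submodule.sub_mem _ ?_ ?_) ?_
  · simpa using C_mul_X_pow_mul_X_pow_mem (a := 12) (b := 0) (n := 12) (1 : ZMod 7) rfl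
  · simpa using C_mul_X_pow_mul_X_pow_mem (a := 6) (b := 6) (n := 12) (1 : ZMod 7) rfl
  · simpa using C_mul_X_pow_mul_X_pow_mem (a := 0) (b := 12) (n := 12) (1 : ZMod 7) rfl

/-- The cocycle vanishes on the centre `{±1}`: `c(z) = 0` (`z · e = r¹² e = e`). [folklore] -/
theorem cpsCocycleFun_eq_zero_of_mem_center {z : Matrix.SpecialLinearGroup (Fin 2) (ZMod 7)}
    (hz : z ∈ Subgroup.center (Matrix.SpecialLinearGroup (Fin 2) (ZMod 7))) :
    cpsCocycleFun z = 0 := by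
  obtain ⟨r, hr, hrz⟩ := Matrix.SpecialLinearGroup.mem_center_iff.1 hz
  simp only [Fintype.card_fin] at hr
  apply Subtype.ext
  rw [Submodule.coe_zero]
  apply cpsCocycleFun_eq_of_eq
  rw [mul_zero, sub_eq_zero, ← hrz]
  change symAct (Matrix.scalar (Fin 2) r) e7 = e7
  rw [symAct_scalar_of_mem r e7_mem, show (12 : ℕ) = 2 * 6 from rfl, pow_mul, hr, one_pow,
    one_smul]

/-- The cocycle is constant on cosets of the centre. [folklore] -/
theorem cpsCocycleFun_mul_of_mem_center (g : Matrix.SpecialLinearGroup (Fin 2) (ZMod 7))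
    {z : Matrix.SpecialLinearGroup (Fin 2) (ZMod 7)}
    (hz : z ∈ Subgroup.center (Matrix.SpecialLinearGroup (Fin 2) (ZMod 7))) :
    cpsCocycleFun (g * z) = cpsCocycleFun g := by
  rw [cpsCocycleFun_mul, cpsCocycleFun_eq_zero_of_mem_center hz, map_zero, zero_add]

/-- **The descended cocycle** `c̄ : PSL₂(𝔽₇) → Sym⁴`, `c̄(ḡ) = c(g)`. [folklore] -/
def pslCocycleFun : Matrix.ProjectiveSpecialLinearGroup (Fin 2) (ZMod 7) → BinaryForms (ZMod 7) 4 :=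
  Quotient.lift (s := QuotientGroup.leftRel (Subgroup.center (Matrix.SpecialLinearGroup (Fin 2) (ZMod 7))))
    cpsCocycleFun fun a b hab => by
    have h : a⁻¹ * b ∈ Subgroup.center (Matrix.SpecialLinearGroup (Fin 2) (ZMod 7)) :=
      QuotientGroup.leftRel_apply.1 hab
    rw [← cpsCocycleFun_mul_of_mem_center a h, mul_inv_cancel_left]

/-- `c̄(ḡ) = c(g)`. [folklore] -/
@[simp] theorem pslCocycleFun_mk (g : Matrix.SpecialLinearGroup (Fin 2) (ZMod 7)) :
    pslCocycleFun (QuotientGroup.mk g) = cpsCocycleFun g := rfl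

/-- The cocycle identity on `PSL₂(𝔽₇)`. [folklore] -/
theorem pslCocycleFun_mul (x y : Matrix.ProjectiveSpecialLinearGroup (Fin 2) (ZMod 7)) :
    pslCocycleFun (x * y) = psl2SymRep (ZMod 7) 4 even_four x (pslCocycleFun y) + pslCocycleFun x := by
  induction x using QuotientGroup.induction_on with
  | H g =>
    induction y using QuotientGroup.induction_on with
    | H h =>
      rw [← QuotientGroup.mk_mul, pslCocycleFun_mk, pslCocycleFun_mk, pslCocycleFun_mk, psl2SymRep_mk,
        cpsCocycleFun_mul]

/-- The descended cocycle in Mathlib's `Z¹(PSL₂(𝔽₇), Sym⁴)`. [folklore] -/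
def pslCocycle : groupCohomology.cocycles₁ (psl2Sym (ZMod 7) 4 even_four) :=
  ⟨pslCocycleFun, (groupCohomology.mem_cocycles₁_iff (A := psl2Sym (ZMod 7) 4 even_four)
    pslCocycleFun).2 fun x y => pslCocycleFun_mul x y⟩

/-- **`H¹(PSL₂(𝔽₇), Sym⁴) ≠ 0`**: the class of `c̄` is non-zero (a coboundary for `PSL₂` would
pull back to a coboundary for `SL₂`). [cite: Humphreys2005, §12.2 Proposition (b)] -/
theorem H1π_pslCocycle_ne_zero :
    groupCohomology.H1π (psl2Sym (ZMod 7) 4 even_four) pslCocycle ≠ 0 := by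
  intro h0
  rw [groupCohomology.H1π_eq_zero_iff] at h0
  obtain ⟨m, hm⟩ := h0
  refine cpsCocycleFun_not_coboundary ⟨m, fun g => ?_⟩
  have hg := congrFun hm (QuotientGroup.mk g)
  change psl2SymRep (ZMod 7) 4 even_four (QuotientGroup.mk g) m - m =
    pslCocycleFun (QuotientGroup.mk g) at hg
  rwa [psl2SymRep_mk, pslCocycleFun_mk] at hg

/-- **`H¹(PSL₂(𝔽₇), Sym⁴ 𝔽₇²) ≠ 0`** for the simple group `PSL₂(𝔽₇)` (order `168`) and its
`5`-dimensional simple module `L(4) = Sym⁴` in characteristic `7`: the `H¹`-vanishing clause of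
adequacy (Thorne 2012, Def. 2.3) fails for image `PSL₂(𝔽₇)` at `p = 7`.
[cite: Humphreys2005, §12.2 Proposition (b)] -/
theorem nontrivial_H1_psl2Sym_four_zmod_seven :
    Nontrivial (groupCohomology.H1 (psl2Sym (ZMod 7) 4 even_four)) :=
  ⟨⟨_, 0, H1π_pslCocycle_ne_zero⟩⟩

end SevenPSL

end Literature.RepresentationTheory.FiniteGroups
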